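import Summits.BirchSwinnertonDyer.BirchSwinnertonDyer.Theses.PrintX6
import Summits.BirchSwinnertonDyer.Rank1Residual.Supersingular.X6RankZeroWitness12927e1LowerHalf
import Summits.BirchSwinnertonDyer.Rank1Residual.X6.RankZeroCertificateErratumDisplay
import Literature.NumberTheory.EllipticCurves.ComplexMultiplicationNotSemistable
import HarnessLib

/-!
# Route `PrintX6`, residual `EisensteinHalfFiveLeRest` (stmt-BirchSwinnertonDyer-21116): its standing hypotheses INHABITED at the
# cell `(12927e1, p = 7)` in the kernel — `¬ HasCM ∧ 5 ≤ 7 ∧ ClassX6 W 7 ∧ r_an = 0 ∧ ¬ HasErratumPrime W 7`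
# (cell `bsd-print-x6`, seat p4 gen 3; companion of `PrintX6Cell12927e1FromInputs.lean` p553369, which proves the Rest CONCLUSION and
# `BSD(E,7)` at the same cell; `--supports` stmt-21116 as helper; closes no item)

PARTITION currency (D-0054): nothing booked; per pair; BEYOND-PRINT THEOREM: **NO**. Why a separate module: the erratum-prime certificate
display `Rank1Residual/X6/RankZeroCertificateErratumDisplay` (ty3, p551397; 734 records, `decide +kernel`) is imported here only, so the
vehicle p553369 keeps its light closure. Sources of the five conjuncts: `ClassX6.not_hasCM` (semistable ⇒ no CM: Ogg / ATAEC II.6.4, tree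
theorem); `classX6_of_intModel` + `card_c12927e1_7` (p551746); the enclosure `hball0` (L(E,1) ≠ 0 ⇒ r_an = 0, with modularity = conjunct 8
of `PublishedInputsX6`); the Rest certificate of record `12927e1@7` in `PrintCert.records16` (`Record.not_hasErratumPrime_of_check`: all
bad primes `3, 31, 139` split multiplicative). References: [SilvermanATAEC1994] II.6.4; [SilvermanAEC2009] VII.5.1; [Miller2011LMS]
Def 1.1; [Cremona2006] Table 1.
-/

set_option autoImplicit false
set_option linter.dupNamespace false

noncomputable section

open scoped Classical MatrixGroups ModularForm

open CongruenceSubgroup WeierstrassCurve Literature.NumberTheory.EllipticCurves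
  Literature.NumberTheory.EllipticCurves.Rank1Residual
  Literature.NumberTheory.EllipticCurves.Rank1Residual.Typed
  Literature.NumberTheory.EllipticCurves.ModularForms
  Summit.BirchSwinnertonDyer.BirchSwinnertonDyer.Rank1Residual.IntModel
  Summit.BirchSwinnertonDyer.Rank1Residual.X11b
  Summit.BirchSwinnertonDyer.Rank1Residual.Supersingular
  Summit.BirchSwinnertonDyer.BirchSwinnertonDyer.Theses.PrintX6

namespace Summit.BirchSwinnertonDyer.BirchSwinnertonDyer.Theorems.PrintX6

/-- **The Rest child is INHABITED at the cell, in the kernel**: every standing hypothesis of `EisensteinHalfFiveLeRest`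
(stmt-BirchSwinnertonDyer-21116) holds at `E = 12927e1`, `p = 7` — `¬ HasCM` (`ClassX6.not_hasCM`: semistable ⇒ no CM, Ogg /
ATAEC II.6.4), `5 ≤ 7`, `ClassX6 W 7` (integer model + point count `#Ẽ(𝔽₇) = 8`, `gcd(Δ, c₄) = 1`), `r_an = 0` (the enclosure
`hball0` + modularity = conjunct 8 of `PublishedInputsX6`), and `¬ HasErratumPrime W 7` (the typer's kernel certificate: record
`12927e1@7` of `PrintCert.records16` carries the Rest certificate — all bad primes `3, 31, 139` split — `Record.not_hasErratumPrime_of_check`).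
So the residual is exercised NON-VACUOUSLY by `X6.eisensteinHalfFiveLeRest_cell_12927e1_at7_of_publishedInputsX6`.
[cite: SilvermanATAEC1994, Thm. II.6.4] [cite: SilvermanAEC2009, VII.5 Prop. 5.1] [cite: Miller2011LMS, Def. 1.1]
[cite: Cremona2006, Table 1 (Cremona label 12927e1)] -/
theorem X6.eisensteinHalfFiveLeRest_hypotheses_12927e1_at7_of_publishedInputsX6 (hPub : PublishedInputsX6)
    {W : WeierstrassCurve ℚ} [W.IsElliptic] [W.IsGloballyMinimal]
    (hWeq : W = ⟨1, 0, 0, -42189461, -105479619702⟩)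
    {N : ℕ} [NeZero N] (f : CuspForm (Gamma0 N) 2)
    (hball0 : ∃ mid rad : ℝ, rad ≤ 1 / 10 ^ (20 : ℕ) ∧ |mid - ((98 : ℤ) : ℝ)| ≤ 1 / 10 ^ (20 : ℕ) ∧
      |((1 : ℕ) : ℝ) * (((1 : ℕ) : ℝ) * ((W.entireLFunction 1).re / plusPeriod f)) - mid| ≤ rad) :
    haveI : Fact (Nat.Prime 7) := ⟨by norm_num⟩
    ¬ W.HasCM ∧ 5 ≤ 7 ∧ ClassX6 W 7 ∧ W.analyticRank = 0 ∧ ¬ HasErratumPrime W 7 := by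
  haveI : Fact (Nat.Prime 7) := ⟨by norm_num⟩
  have hIW : integralModelInt W = ⟨1, 0, 0, -42189461, -105479619702⟩ :=
    integralModelInt_eq_of_map_eq _ (by rw [hWeq]; ext <;> simp [WeierstrassCurve.map])
  have hX : ClassX6 W 7 :=
    classX6_of_intModel 7 (by norm_num) hIW (by decide +kernel) card_c12927e1_7 (by decide) (by decide +kernel)
  have hL : W.entireLFunction 1 ≠ 0 := by
    obtain ⟨mid, rad, hrad, hmid, hball⟩ := hball0
    intro hL0
    rw [hL0] at hball
    simp only [Complex.zero_re, zero_div, mul_zero, zero_sub, abs_neg] at hball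
    rw [abs_le] at hmid hball
    norm_num at hmid hball hrad
    linarith [hmid.1, hball.2]
  have hr0 : W.analyticRank = 0 := (W.analyticRank_eq_zero_iff_holds (hPub.2.2.2.2.2.2.2.1 W)).2 hL
  -- the Rest certificate of record 12927e1@7 (all bad primes split), kernel
  have hRest : ¬ HasErratumPrime W 7 := by
    obtain ⟨r, hr, hA, hp, he⟩ : ∃ r ∈ Summit.BirchSwinnertonDyer.Rank1Residual.X6.PrintCert.records16,
        r.ainvs = [1, 0, 0, -42189461, -105479619702] ∧ r.p = 7 ∧ r.restAt = true := by
      decide +kernel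
    have hc := Summit.BirchSwinnertonDyer.Rank1Residual.X6.PrintCert.check_of_mem_of_certified
      Summit.BirchSwinnertonDyer.Rank1Residual.X6.PrintCert.certified_records16 hr
    have hW : W = r.curve := by rw [hWeq]; exact r.curve_eq hA
    subst hW
    rw [← hp]
    exact r.not_hasErratumPrime_of_check hc he
  exact ⟨ClassX6.not_hasCM W hX, by norm_num, hX, hr0, hRest⟩

end Summit.BirchSwinnertonDyer.BirchSwinnertonDyer.Theorems.PrintX6

end
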